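import Summits.QuantumFields.YangMills.Theorems.ParabolicTrajectoryContinuumLimitOnTrajectoryStubTranslA
import Summits.QuantumFields.YangMills.Theorems.ParabolicTrajectoryContinuumLimitOnTrajectoryDefsC

/-!
# Stub `stub_transl : TranslOfUUVB` (line `two-orbit-synchronisation`, crux stmt-QuantumFields-10522) — helper B: `o(1)` relocation and the `UUVB` bound

Second helper file of the stub worker for `stub_transl` (seat c2, wave 1).
* §1 MULTILINEAR EXPANSION: `r.curvature = ∑_{μ<ν} plaq (μ,ν)` and `⟨P⟩_k = ∑_q ⟨plaq_q⟩_k`, so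
  `∏ᵢ (P(xᵢ) - ⟨P⟩) = ∑_{q : Fin p → PlaqIdx} ∏ᵢ (plaq_{qᵢ}(xᵢ) - ⟨plaq_{qᵢ}⟩)` (`Finset.prod_univ_sum`) and
  `curvDistribution k p F = ∑_q canonDistribution k p (plaq ∘ q) F` (`Transl.curvDistribution_eq_sum_canonDistribution`);
  hence `UUVB` bounds the canonical curvature distributions on `⁰𝒮` with the SAME uniform threshold:
  `‖curvDistribution k p F‖ ≤ 6^p α (p!)^β |F|_{p s}` (`Transl.norm_curvDistribution_le_of_uuvb`, `6 = card PlaqIdx` kept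
  symbolic).
* §2 THE SEAM IS `o(1)` UNDER `PolyVolumeGrowth`: helper A's bound `(2L_k+1)^{4p} 2C^p ‖F‖_{N,0} (a_k L_k - R)^{-N}` with
  `2L_k+1 ≤ 3 a_k⁻¹ (a_k L_k) ≤ 3 (a_k L_k)^{N₀+1}` and `N = 4p(N₀+1)+1` is `≤ K_{p,N,F} / (a_k L_k) → 0`
  (`Transl.seam_bookkeeping`); the registered anchor `translB_eventually_norm_translate_sub_le` is the reusable
  RELOCATION LEMMA: under `PolyVolumeGrowth`, for all `p F R ε`, eventually in `k`, for EVERY lattice vector `v` with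
  `‖a_k v‖ ≤ R`, `‖curvDistribution k p (F(· - a_k v)) - curvDistribution k p F‖ ≤ ε`.
-/

set_option autoImplicit false

open scoped SchwartzMap
open MeasureTheory Filter Topology
open Literature.MathematicalPhysics.QuantumFieldTheory Literature.MathematicalPhysics.QuantumLattice
open Literature.MathematicalPhysics.AQFT
open Literature.Probability.LatticeModels (Site box mem_box card_box)
open Summit.QuantumFields.YangMills.Theses.ParabolicTrajectory

noncomputable section

namespace Summit.QuantumFields.YangMills.Cruxes.ContinuumLimitOnTrajectory.TwoOrbitSynchronisation

namespace Transl

/-! ### §1 Multilinear expansion into plaquette strings; `curvDistribution` under `UUVB` -/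

section Expansion

variable {G : Type} [Group G] [TopologicalSpace G] [IsTopologicalGroup G] [CompactSpace G]
  [MeasurableSpace G] [BorelSpace G]

/-- The curvature species is the sum of the six plaquette species: `P = ∑_{μ<ν} Re tr U_{μν}`. -/
theorem curvature_F_eq_sum_plaq (r : LatticeRep G) (V : LGConfig 4 G) :
    r.curvature.F V = ∑ q : PlaqIdx, (plaq r q).F V := by
  show actionDensity r.ρ V = ∑ q : PlaqIdx, plaquetteObs r.ρ 0 q.1.1 q.1.2 V
  unfold actionDensity
  rw [← Finset.sum_product', Finset.univ_product_univ, ← Finset.sum_filter]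
  exact (Finset.sum_subtype _ (fun q => by simp) fun q : Fin 4 × Fin 4 => plaquetteObs r.ρ 0 q.1 q.2 V)

/-- The torus mean is additive over the plaquette species: `⟨P⟩ = ∑_q ⟨plaq_q⟩`. -/
theorem wilsonTorusMean_curvature (r : LatticeRep G) (β : ℝ) (L : ℕ) :
    wilsonTorusMean r.ρ β L r.curvature.F = ∑ q : PlaqIdx, wilsonTorusMean r.ρ β L (plaq r q).F := by
  unfold wilsonTorusMean
  rw [← integral_finsetSum]
  · exact integral_congr_ae (Eventually.of_forall fun U => curvature_F_eq_sum_plaq r _)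
  · intro q _
    obtain ⟨C, hC⟩ := (plaq r q).bounded
    haveI := isProbabilityMeasure_wilsonMeasure (d := 4) (L := 2 * L + 1) r.ρ r.continuous β
    exact Integrable.of_bound (((plaq r q).measurable.comp (measurable_torusLift _)).aestronglyMeasurable) C
      (Eventually.of_forall fun U => by rw [Real.norm_eq_abs]; exact hC _)

/-- Each centred curvature factor is the sum over plaquette orientations of the centred plaquette factors. -/
theorem centred_curvature_eq_sum (r : LatticeRep G) (sch : SpeciesScheme (YMSpecies G)) (k : ℕ) (V : LGConfig 4 G) :
    (((r.curvature.F V - wilsonTorusMean r.ρ (sch.β k) (sch.L k) r.curvature.F : ℝ)) : ℂ) =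
      ∑ q : PlaqIdx, ((((plaq r q).F V - wilsonTorusMean r.ρ (sch.β k) (sch.L k) (plaq r q).F : ℝ)) : ℂ) := by
  rw [curvature_F_eq_sum_plaq, wilsonTorusMean_curvature r, ← Finset.sum_sub_distrib, Complex.ofReal_sum]

/-- Integrability of the plaquette-string summands (finite sums of products of bounded measurable factors). -/
theorem integrable_string_sum (r : LatticeRep G) (sch : SpeciesScheme (YMSpecies G)) (k p : ℕ)
    (q : Fin p → PlaqIdx) (F : 𝓢((Fin p → EuclideanSpace ℝ (Fin 4)), ℂ)) :
    Integrable (fun U => ∑ x : Fin p → ↥(box 4 (sch.L k)), F (fun i => sch.a k • siteToE (↑(x i) : Site 4)) *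
      ∏ i, ((((plaq r (q i)).F (configShift (-(↑(x i) : Site 4)) (torusLift (sch.side k) U)) -
          wilsonTorusMean r.ρ (sch.β k) (sch.L k) (plaq r (q i)).F : ℝ)) : ℂ)) (μW r sch k) := by
  refine integrable_finsetSum _ fun x _ => Integrable.const_mul ?_ _
  have hb : ∀ i, ∃ B, ∀ U, ‖((((plaq r (q i)).F (configShift (-(↑(x i) : Site 4)) (torusLift (sch.side k) U)) -
      wilsonTorusMean r.ρ (sch.β k) (sch.L k) (plaq r (q i)).F : ℝ)) : ℂ)‖ ≤ B := by
    intro i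
    obtain ⟨C, hC⟩ := (plaq r (q i)).bounded
    refine ⟨C + |wilsonTorusMean r.ρ (sch.β k) (sch.L k) (plaq r (q i)).F|, fun U => ?_⟩
    rw [Complex.norm_real, Real.norm_eq_abs]
    exact (abs_sub _ _).trans (add_le_add (hC _) le_rfl)
  choose B hB using hb
  refine Integrable.of_bound (C := ∏ i, B i) ?_ (Eventually.of_forall fun U => ?_)
  · refine (Finset.measurable_prod _ fun i _ => ?_).aestronglyMeasurable
    exact Complex.measurable_ofReal.comp
      ((((plaq r (q i)).measurable.comp ((configShift _).measurable.comp (measurable_torusLift _))).sub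
        measurable_const))
  · rw [norm_prod]
    exact Finset.prod_le_prod (fun i _ => norm_nonneg _) fun i _ => hB i U

/-- **Multilinear expansion**: the canonical curvature distribution is the sum over the `6^p` plaquette strings of the
canonical string distributions. -/
theorem curvDistribution_eq_sum_canonDistribution (r : LatticeRep G) (sch : SpeciesScheme (YMSpecies G)) (k p : ℕ)
    (F : 𝓢((Fin p → EuclideanSpace ℝ (Fin 4)), ℂ)) :
    curvDistribution r sch k p F = ∑ q : Fin p → PlaqIdx, canonDistribution r sch k p (fun i => plaq r (q i)) F := by
  rw [← canonDistribution_curvature]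
  unfold canonDistribution
  rw [← integral_finsetSum _ fun q _ => integrable_string_sum r sch k p q F]
  refine integral_congr_ae (Eventually.of_forall fun U => ?_)
  dsimp only
  rw [Finset.sum_comm]
  refine Finset.sum_congr rfl fun x _ => ?_
  rw [← Finset.mul_sum]
  congr 1
  simp_rw [centred_curvature_eq_sum r sch k]
  rw [Finset.prod_univ_sum, Fintype.piFinset_univ]

/-- **`curvDistribution` under `UUVB`**: the uniform-threshold bound `6^p · α (p!)^β |F|_{p s}` on `⁰𝒮`, for ALL `p` and
`F` beyond ONE threshold in `k` (`6 = card PlaqIdx` kept symbolic). -/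
theorem norm_curvDistribution_le_of_uuvb (r : LatticeRep G) (sch : SpeciesScheme (YMSpecies G)) (hU : UUVB r sch) :
    ∃ (s : ℕ) (α β : ℝ), ∀ᶠ k in atTop, ∀ (p : ℕ) (F : 𝓢((Fin p → EuclideanSpace ℝ (Fin 4)), ℂ)), IsOffDiagonal F →
      ‖curvDistribution r sch k p F‖ ≤
        (Fintype.card PlaqIdx : ℝ) ^ p * (α * (p.factorial : ℝ) ^ β * schwartzNorm (p * s) F) := by
  obtain ⟨s, α, β, h⟩ := hU
  refine ⟨s, α, β, h.mono fun k hk p F hF => ?_⟩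
  rw [curvDistribution_eq_sum_canonDistribution]
  refine (norm_sum_le _ _).trans ?_
  refine (Finset.sum_le_sum fun q _ => hk p q F hF).trans ?_
  rw [Finset.sum_const, Finset.card_univ, Fintype.card_fun, Fintype.card_fin, nsmul_eq_mul]
  push_cast
  rfl

end Expansion

/-! ### §2 The seam is `o(1)` under polynomial volume growth -/

section Asymptotics

variable {G : Type} [Group G] [TopologicalSpace G] [IsTopologicalGroup G] [CompactSpace G]
  [MeasurableSpace G] [BorelSpace G]

/-- Pure real-variable bookkeeping of the seam bound: with `X = a L ≥ 1`, `a ≤ 1`, `a⁻¹ ≤ X^N₀`, `R' ≤ X/2`,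
`N = (N₀+1)(4p)+1`, the bound `(2L+1)^{4p} · B / (X - R')^N` is at most `3^{4p} 2^N B / X`. -/
theorem seam_bookkeeping {a X R' B : ℝ} {L N₀ N p : ℕ} (hN : N = (N₀ + 1) * (4 * p) + 1) (ha : 0 < a) (ha1 : a ≤ 1)
    (hX : X = a * L) (hX1 : 1 ≤ X) (hvol : a⁻¹ ≤ X ^ N₀) (hR : 2 * R' ≤ X) (hB : 0 ≤ B) :
    ((2 * (L : ℝ) + 1) ^ 4) ^ p * (B / (X - R') ^ N) ≤ (3 : ℝ) ^ (4 * p) * 2 ^ N * B / X := by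
  have hXpos : 0 < X := by linarith
  have hX0 : X ≠ 0 := hXpos.ne'
  have hY1 : 1 ≤ X ^ (N₀ + 1) := one_le_pow₀ hX1
  have hL : (L : ℝ) = X * a⁻¹ := by rw [hX]; field_simp
  have hXa : X * a⁻¹ ≤ X ^ (N₀ + 1) := by
    rw [pow_succ']
    exact mul_le_mul_of_nonneg_left hvol hXpos.le
  have ha2 : (1 : ℝ) ≤ a⁻¹ := one_le_inv_iff₀.2 ⟨ha, ha1⟩
  have h2L : 2 * (L : ℝ) + 1 ≤ 3 * X ^ (N₀ + 1) := by rw [hL]; nlinarith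
  have hden : X / 2 ≤ X - R' := by linarith
  have hden_pos : 0 < (X / 2) ^ N := pow_pos (by linarith) _
  calc ((2 * (L : ℝ) + 1) ^ 4) ^ p * (B / (X - R') ^ N)
      ≤ ((3 * X ^ (N₀ + 1)) ^ 4) ^ p * (B / (X / 2) ^ N) := by
        refine mul_le_mul ?_ ?_ (div_nonneg hB (pow_nonneg (by linarith) _))
          (pow_nonneg (pow_nonneg (by linarith) 4) p)
        · exact pow_le_pow_left₀ (by positivity) (pow_le_pow_left₀ (by positivity) h2L 4) p
        · exact div_le_div_of_nonneg_left hB hden_pos (pow_le_pow_left₀ (by linarith) hden _)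
    _ = (3 : ℝ) ^ (4 * p) * 2 ^ N * B / X := by
        have hXN : X ^ N = (X ^ (N₀ + 1)) ^ (4 * p) * X := by rw [hN, pow_succ, ← pow_mul]
        have h34 : ((3 * X ^ (N₀ + 1)) ^ 4) ^ p = (3 : ℝ) ^ (4 * p) * (X ^ (N₀ + 1)) ^ (4 * p) := by
          rw [← pow_mul, mul_pow]
        rw [div_pow, hXN, h34]
        have hW : (0 : ℝ) < (X ^ (N₀ + 1)) ^ (4 * p) := by positivity
        generalize (X ^ (N₀ + 1)) ^ (4 * p) = W at hW ⊢
        field_simp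

/-- **Asymptotic relocation, uniform over bounded lattice vectors.** Under `PolyVolumeGrowth`, for every `p`, `F`, `R`
and `ε > 0`: eventually in `k`, for EVERY lattice vector `v` with `‖a_k v‖ ≤ R`,
`‖curvDistribution k p (F(· - a_k v)) - curvDistribution k p F‖ ≤ ε`. -/
theorem eventually_norm_translate_sub_le (r : LatticeRep G) (sch : SpeciesScheme (YMSpecies G))
    (hvol : PolyVolumeGrowth sch) (p : ℕ) (F : 𝓢((Fin p → EuclideanSpace ℝ (Fin 4)), ℂ)) (R ε : ℝ) (hε : 0 < ε) :
    ∀ᶠ k in atTop, ∀ v : Site 4, ‖sch.a k • siteToE v‖ ≤ R →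
      ‖curvDistribution r sch k p (translateMulti (sch.a k • siteToE v) F) - curvDistribution r sch k p F‖ ≤ ε := by
  obtain ⟨C, hC0, hC⟩ := exists_uniform_bound_cw r sch
  obtain ⟨N₀, -, hN₀⟩ := hvol
  set N : ℕ := (N₀ + 1) * (4 * p) + 1 with hN
  set R' : ℝ := max R 0 with hR'
  set B : ℝ := 2 * C ^ p * SchwartzMap.seminorm ℂ N 0 F with hB_def
  have hB : 0 ≤ B := by positivity
  set K : ℝ := (3 : ℝ) ^ (4 * p) * 2 ^ N * B with hK
  have hK0 : 0 ≤ K := by positivity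
  have h1 : ∀ᶠ k in atTop, sch.a k ≤ 1 := (sch.tendsto_a.eventually_lt_const zero_lt_one).mono fun k hk => hk.le
  have h2 : ∀ᶠ k in atTop, max (2 * R' + 2) (K / ε + 1) ≤ sch.a k * sch.L k := tendsto_atTop.1 sch.tendsto_L _
  filter_upwards [h1, h2, hN₀] with k hk1 hk2 hk3 v hv
  set X : ℝ := sch.a k * sch.L k with hX
  have hX2 : 2 * R' + 2 ≤ X := (le_max_left _ _).trans hk2
  have hXK : K / ε + 1 ≤ X := (le_max_right _ _).trans hk2
  have hR0 : 0 ≤ R' := le_max_right _ _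
  have hX1 : 1 ≤ X := by linarith
  have hXpos : 0 < X := by linarith
  have hv' : ‖sch.a k • siteToE v‖ ≤ R' := hv.trans (le_max_left _ _)
  have hRX : R' < sch.a k * sch.L k := by rw [← hX]; linarith
  have hA := translA_norm_translate_sub_le r sch C hC0 hC k p N F v R' hv' hRX
  push_cast at hA
  refine hA.trans ?_
  rw [← hX]
  calc ((2 * (sch.L k : ℝ) + 1) ^ 4) ^ p * (B / (X - R') ^ N)
      ≤ (3 : ℝ) ^ (4 * p) * 2 ^ N * B / X := seam_bookkeeping hN (sch.a_pos k) hk1 hX hX1 hk3 (by linarith) hB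
    _ = K / X := by rw [hK]
    _ ≤ ε := by
        rw [div_le_iff₀ hXpos]
        have h : K / ε ≤ X := by linarith
        rw [div_le_iff₀ hε] at h
        linarith

end Asymptotics

end Transl

/-- **Registered anchor of this helper file — the relocation lemma.** Under polynomial volume growth, translating a test
function by ANY lattice vector `a_k v` of bounded physical length changes the canonical curvature distributions by
`o(1)`, uniformly in `v`: for all `p F R ε`, `ε > 0`, eventually in `k`, for every `v : ℤ⁴` with `‖a_k v‖ ≤ R`,
`‖curvDistribution k p (F(· - a_k v)) - curvDistribution k p F‖ ≤ ε` (exact torus translation invariance of the Wilson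
state relocates the box; the seam is a Schwartz tail against the `a_k^{-4p}` face multiplicity). -/
theorem translB_eventually_norm_translate_sub_le :
    ∀ {G : Type} [Group G] [TopologicalSpace G] [IsTopologicalGroup G] [CompactSpace G]
      [MeasurableSpace G] [BorelSpace G] (r : LatticeRep G) (sch : SpeciesScheme (YMSpecies G)),
      PolyVolumeGrowth sch → ∀ (p : ℕ) (F : 𝓢((Fin p → EuclideanSpace ℝ (Fin 4)), ℂ)) (R ε : ℝ), 0 < ε →
      ∀ᶠ k in atTop, ∀ v : Site 4, ‖sch.a k • siteToE v‖ ≤ R →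
        ‖curvDistribution r sch k p (translateMulti (sch.a k • siteToE v) F) - curvDistribution r sch k p F‖ ≤ ε := by
  intro G _ _ _ _ _ _ r sch hvol p F R ε hε
  exact Transl.eventually_norm_translate_sub_le r sch hvol p F R ε hε

end Summit.QuantumFields.YangMills.Cruxes.ContinuumLimitOnTrajectory.TwoOrbitSynchronisation

end
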